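import Summits.HodgeConjecture.HodgeConjecture.Theorems.F0P3CohFormsTowerIso
import Summits.HodgeConjecture.HodgeConjecture.Theorems.A3Liu413TowerAdmissible
import HarnessLib

/-!
# FLOOR-0 P2a (B4-ARCHIMEDEAN DESK, line 2) — AT THE PIN: the `K`-fixed cohomological cotangent forms are finite-dimensional

Cell hodgecm-mathlib (D-0151), FLOOR 0, crux item H413 = stmt-HodgeConjecture-24833 (route `HCCMUnconditional`); line
`Cruxes/H413/Lines/F0_P2aCohIsotypicLine.lean` (sha16 fe64be0a9875628f), stub S3 `stub_admissible_of_cohValued :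
AdmissibleOfCohValuedType`; prover F0P2a-p07 (g0).  `--supports stmt-HodgeConjecture-24833` (helper).  THEOREMS ONLY — no definition,
no instance, no notation, no named fact, no `sorry`; imports = ★ tree.

The one theorem `finite_cohForms_inf_invariants`: for the archimedean factor OF RECORD `archFactorOf F V` of a hermitian 3-space `V`
over a CM field `F` with `4 ≤ [F:ℚ]`, and every OPEN COMPACT subgroup `K ≤ U(V)(𝔸_{F⁺,f})`, the space of cohomological cotangent forms
`Φ ∈ cohForms (archFactorOf F V)` that are RIGHT-`K`-INVARIANT (`rightRep F V k Φ = Φ`, `k ∈ K`) is FINITE-DIMENSIONAL — i.e. the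
`(1,0) ⊕ (0,1)` forms of level `K` are `H^{1,0} ⊕ H^{0,1}` of the compact level-`K` ball quotient.  Proof: the Matsushima–Hodge class map
★ `CuspCot.exists_cohClassMap_bijective` (F0P3-p01, p793103) is an INJECTIVE `U(V)(𝔸_f)`-equivariant linear map
`cohForms (archFactorOf F V) → H = colim_K H¹(X_K(ℂ); ℂ)`, so it carries `K`-invariant forms into the `K`-fixed vectors of the tower,
which are finite-dimensional by ★ `HodgeCM.Model.TowerCarrier.isAdmissibleRep_ofModule'_tower` (A-fan, `Theorems/A3Liu413TowerAdmissible`: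
finiteness of the class set + `H¹(X_K(ℂ); ℚ)` finite-dimensional).  The records `exists_isReal_hodgeModel`, `hodgePQ_independent_of_hodgeModel`,
`BallQuotientUniformised`, `CMAbelianVarietyEigenbasisRealised`, `Arapura2012_Cor_15_4_6` enter by their ★ `_holds` theorems (as in ★
`CuspCot.t2Bijective_pin`), so the statement is unconditional.

This is the pin half of S3 (`AdmissibleOfCohValuedType`): an irreducible smooth `σ` with a non-zero equivariant map into the cohomological
cotangent forms is admissible because `σ^K ↪ (cohForms)^K`; the other half is the frame transport `(L, ι, H, T, hT) ↦ archFactorOf ⟨L⟩ V`.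
HC_CM is proved only modulo the printed citations until rung 0 closes; this file proves nothing about them.

## References
* [BorelWallach2000] A. Borel, N. Wallach, *Continuous cohomology, discrete subgroups, and representations of reductive groups*, 2nd ed.
  (2000), VII 3.2 (Matsushima), XIII 1.2 (the adelic tower is admissible).
* [BernsteinZelevinsky1976] I. N. Bernstein, A. V. Zelevinsky, Russian Math. Surveys 31 (1976), §2.1 (admissible representations).
* [Liu2021] Y. Liu, Camb. J. Math. 9 (2021), §4.2 l. 2081 («`H¹_{B,τ'}(A_∞, ℂ)` is an admissible representation»).
* Tree: ★ `Theorems/F0P3CohFormsTowerIso` (`CuspCot.exists_cohClassMap_bijective`), ★ `Theorems/A3Liu413TowerAdmissible`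
  (`isAdmissibleRep_ofModule'_tower`), ★ `HodgeCM/Model/TowerAlgebra` (`of_smul_eq_act`), ★
  `Literature/RepresentationTheory/Semisimple/EquivariantIrreducibleDecomposition` (`ofModule'_apply_eq_of_smul`).
-/

set_option autoImplicit false
set_option linter.dupNamespace false

noncomputable section

open NumberField
open Literature.AlgebraicGeometry.HodgeTheory
open Literature.NumberTheory.Automorphic Literature.NumberTheory.Automorphic.PicardCM
open Literature.NumberTheory.Transcendental (Arapura2012_Cor_15_4_6 arapura2012_cor_15_4_6_holds)
open HodgeCM HodgeCM.Model HodgeCM.Model.TowerCarrier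
open Summit.HodgeConjecture.CorCM
open Summit.HodgeConjecture.HodgeConjecture.Cruxes.H413.CohFormsCarriers
open Summit.HodgeConjecture.HodgeConjecture.Cruxes.H413.CuspCot

namespace Summit.HodgeConjecture.HodgeConjecture.Cruxes.H413.F0P2aCohFormsFixedFinite

/-- **Records-generic form.**  For the records `hHD, hI, h₁, h₃, hA` of the tower and `V` anisotropic over a CM field `F` with `[F:ℚ] ≠ 2`,
the right-`K`-invariant cohomological cotangent forms of the factor of record (`K ≤ U(V)(𝔸_{F⁺,f})` open compact) are finite-dimensional:
`cohForms (archFactorOf F V) ⊓ (K-invariants of rightRep)` embeds, by the injective equivariant class map ★ `exists_cohClassMap_bijective`,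
into the `K`-fixed vectors of the admissible tower (★ `isAdmissibleRep_ofModule'_tower`). [cite: BorelWallach2000, VII 3.2 and XIII 1.2]
[cite: Liu2021, §4.2 l. 2081] -/
theorem finite_cohForms_inf_invariants_of_records (hHD : exists_isReal_hodgeModel) (hI : hodgePQ_independent_of_hodgeModel)
    (h₁ : BallQuotientUniformised) (h₃ : CMAbelianVarietyRealised) (hA : Arapura2012_Cor_15_4_6)
    {F : HodgeCM.CMField} {ι₁ : F →+* ℂ} (V : HodgeCM.HermSpace3 F ι₁) (hV : IsAnisotropic F (HodgeCM.HermSpace3.Hm V))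
    (hL : Module.finrank ℚ F ≠ 2) (K : Subgroup ↥(HodgeCM.HermSpace3.adelicFin V))
    (hKo : IsOpen (K : Set ↥(HodgeCM.HermSpace3.adelicFin V))) (hKc : IsCompact (K : Set ↥(HodgeCM.HermSpace3.adelicFin V))) :
    Module.Finite ℂ ↥(cohForms (archFactorOf F V) ⊓ Representation.invariants ((rightRep F V).comp K.subtype)) := by
  obtain ⟨cls, hbij, heqv⟩ := exists_cohClassMap_bijective hHD hI h₁ h₃ hA hV
  haveI hfin := isAdmissibleRep_ofModule'_tower hHD hI (ballQuotientUniformisedDatum_of h₁) h₃ hA V hL K ⟨hKo, hKc⟩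
  -- the class map restricted to the `K`-invariant forms
  let φ : ↥(cohForms (archFactorOf F V) ⊓ Representation.invariants ((rightRep F V).comp K.subtype)) →ₗ[ℂ]
      Tower hHD hI (ballQuotientUniformisedDatum_of h₁) h₃ hA V :=
    cls ∘ₗ Submodule.inclusion inf_le_left
  have hφ : Function.Injective φ := hbij.1.comp (Submodule.inclusion_injective _)
  -- its range consists of `K`-fixed vectors of the tower
  -- (stated as `fixedSubmodule ≥ range φ` so that the `AddCommGroup` instance of the tower is synthesised first)
  have hle : Liu2021.fixedSubmodule (V := Tower hHD hI (ballQuotientUniformisedDatum_of h₁) h₃ hA V)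
      (Representation.ofModule' (k := ℂ) (G := ↥(HodgeCM.HermSpace3.adelicFin V))
        (Tower hHD hI (ballQuotientUniformisedDatum_of h₁) h₃ hA V)) K ≥ LinearMap.range φ := by
    rintro _ ⟨⟨f, hfcoh, hfK⟩, rfl⟩
    rw [Liu2021.mem_fixedSubmodule_iff]
    intro k hk
    refine (Literature.RepresentationTheory.Semisimple.ofModule'_apply_eq_of_smul (k := ℂ)
      (G := ↥(HodgeCM.HermSpace3.adelicFin V)) (Tower hHD hI (ballQuotientUniformisedDatum_of h₁) h₃ hA V) k _).trans ?_
    rw [of_smul_eq_act]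
    have hfix : rightRep F V k f = f := by
      have h := (Representation.mem_invariants _ f).1 hfK ⟨k, hk⟩
      simpa only [MonoidHom.coe_comp, Subgroup.coe_subtype, Function.comp_apply] using h
    have hgf : rightRep F V k f ∈ cohForms (archFactorOf F V) := hfix.symm ▸ hfcoh
    have h1 := heqv k ⟨f, hfcoh⟩ hgf
    have h2 : (⟨rightRep F V k f, hgf⟩ : ↥(cohForms (archFactorOf F V))) = ⟨f, hfcoh⟩ := Subtype.ext hfix
    rw [h2] at h1
    -- `h1 : cls ⟨f, hfcoh⟩ = act k (cls ⟨f, hfcoh⟩)`, and `φ ⟨f, _⟩ = cls ⟨f, hfcoh⟩` by `rfl`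
    exact h1.symm
  have hfinR : Module.Finite ℂ ↥(LinearMap.range φ) :=
    @Submodule.finiteDimensional_of_le ℂ (Tower hHD hI (ballQuotientUniformisedDatum_of h₁) h₃ hA V) _ _ _ _ _ hfin hle
  exact @Module.Finite.equiv ℂ ↥(LinearMap.range φ) _ _ _ _ _ _ hfinR (LinearEquiv.ofInjective φ hφ).symm

/-- **AT THE PIN: the right-`K`-invariant `(1,0) ⊕ (0,1)` cotangent forms are finite-dimensional** (`4 ≤ [F:ℚ]` ⇒ `V` anisotropic and
`[F:ℚ] ≠ 2`; the five records discharged by their ★ `_holds` theorems, exactly as in ★ `CuspCot.t2Bijective_pin`).  This is the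
finite-dimensionality input of stub S3 `AdmissibleOfCohValuedType` of the B4-archimedean desk's line 2.
[cite: BorelWallach2000, VII 3.2 and XIII 1.2] [cite: BernsteinZelevinsky1976, §2.1] [cite: Liu2021, §4.2 l. 2081] -/
theorem finite_cohForms_inf_invariants (F : HodgeCM.CMField) {ι₁ : F →+* ℂ} (V : HodgeCM.HermSpace3 F ι₁)
    (h4 : 4 ≤ Module.finrank ℚ F) (K : Subgroup ↥(HodgeCM.HermSpace3.adelicFin V))
    (hKo : IsOpen (K : Set ↥(HodgeCM.HermSpace3.adelicFin V))) (hKc : IsCompact (K : Set ↥(HodgeCM.HermSpace3.adelicFin V))) :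
    Module.Finite ℂ ↥(cohForms (archFactorOf F V) ⊓ Representation.invariants ((rightRep F V).comp K.subtype)) :=
  finite_cohForms_inf_invariants_of_records exists_isReal_hodgeModel_holds hodgePQ_independent_of_hodgeModel_holds
    Summit.HodgeConjecture.CorCM.BallQuotient.ballQuotientUniformised_holds
    (cmAbelianVarietyRealised_of_eigenbasis exists_isReal_hodgeModel_holds hodgePQ_independent_of_hodgeModel_holds
      Summit.HodgeConjecture.CorCM.cmAbelianVarietyEigenbasisRealised_holds)
    arapura2012_cor_15_4_6_holds V (HodgeCM.HermSpace3.isAnisotropic V h4) (by omega) K hKo hKc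

end Summit.HodgeConjecture.HodgeConjecture.Cruxes.H413.F0P2aCohFormsFixedFinite

end
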